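import Summits.QuantumFields.BalabanUV.Beta.EriceRemainderEnclosureHistoryAutonomyComparisonAgeCompositionStaticChainNormalForm

/-!
# EriceRemainderEnclosureHistoryAutonomyComparisonAgeCompositionStaticChainHyperbolic — (E72c) THE HYPERBOLIC MAJORANT OF THE PERSISTENCE DEFECT,
# `θ̄(r) = 1 − (r∕(r+1))^{3∕2}·e^{−1∕(2r)} ≤ 2∕(r + 6∕5)` for every `r > 0`, its range and monotonicity, and the far decay of the crude chain's defects —
# the real-variable inequality that makes the hyperbolic chain of (E72a)∕(E72b) a MAJORANT of the crude budget-form chain of route (N)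

Cell `pub-balaban`, β-function sub-cell, BINDER row D4 «RemainderConst leaves for Bałaban's split» (`HOME/BINDER-OWNERS.md`; owner lineage `b2b-balaban-beta-an4`;
this file by co-owner #2 lineage `b2b-balaban-beta-d4-p2`, generation 63), β-FLOW TEAM duty (1), FREEZE (0) honoured (def-free; imports (E72b)
`…StaticChainNormalForm` and uses its `hyperbolic_weight_decay` BY NAME; nothing restated).

HONEST FRAMING (page 1, verbatim and binding).  *"Discharging BetaPertH makes Bałaban's UV stability UNCONDITIONAL — a real constructive-QFT result; it is
NOT the continuum limit and NOT the Clay problem."*  THIS FILE DISCHARGES NOTHING OF THE KIND.  Elementary real analysis (`1 + x ≤ eˣ`, `√(1+u) ≤ 1 + u∕2` and a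
cubic polynomial identity) about the census's own crude persistence defect; the form, signs, ages and moments of Bałaban's (1.22) limit functional are NOT
PRINTED ([I] p. 298; GAPS G-t4-U2-1∕-2) and NOT asserted.  Row D4 class UNCHANGED (critical-path width 0; instance 0∕1; D4 DISCHARGE NO DATE).  HONEST
DEPENDENCY: continuum YM on T⁴ ⇐ BetaPertH ∧ nine spine estimates (0/9 proved); BetaPertH ⇐ (D1) ∧ (D4) ∧ CAP+tail; G-an2-4 gates asym, D1 and NE2/3/4.

THE POINT (census sense (α); route (N), READMEs `g62/e71` §PS3 and `g63/e72` §§3–4).  The crude budget-form chain bounds the persistence defect of an old age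
`k` seen from the young scale `y` by `θ̄(k∕y)`, `θ̄(r) = 1 − (r∕(r+1))^{3∕2}·e^{−1∕(2r)}` ((E58b) concavity `a_{k+y} ≤ a_k(1 + y∕k)` for the cube of the
`h`-ratio, (E63a)'s read-weight bound `f_i ≤ inc_{i−1}∕(2a_{i+1})` with `Π g ≥ e^{−Σ f}` for the damping — README g62 §PS3; the identification is bookkeeping
of those files and is NOT re-derived here: this file is about the real function only, written with `√` instead of the `3∕2` power).  (E72a)'s MAJORANT
PRINCIPLE lets one replace `θ̄` by any larger defect; (E72b)'s near∕far recursion is cleanest for HYPERBOLIC weights `2∕(r + a)`, whose decay between target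
scales is the exact factor `δ(R) = (1+a)∕(R+a)` (`hyperbolic_weight_decay`).  §1–§2 prove **`thetabar_le_hyperbolic`: `θ̄(r) ≤ 2∕(r + 6∕5)` for all `r > 0`**
from `e^{−1∕(2r)} ≥ 1 − 1∕(2r)`, `√(r∕(r+1)) ≥ 2r∕(2r+1)` and `r(2r−1)(5r+6) − (5r−4)(r+1)(2r+1) = r + 4 > 0` (numerically the best constant is `a = 1.375`,
asymptotically sharp since `θ̄ = 2∕r − 2.75∕r² + O(r⁻³)`; `6∕5` keeps a margin `≥ 0.1∕r² + O(r⁻³)` and an elementary proof); §3 records `0 ≤ θ̄ ≤ 1` and that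
`θ̄` is non-increasing (so the Abel increments of (E72a) `load_abel` are `≥ 0` for the crude chain); §4 combines with `hyperbolic_weight_decay`:
**`thetabar_far_decay`: `θ̄(k∕z) ≤ (11∕(5R+6))·(2Rz∕(k + (6∕5)Rz))` for `k ≥ Rz`** — the far defects of the crude chain seen from `z` are at most `δ(R) = 11∕(5R+6)`
times the hyperbolic defects seen from `Rz` (`δ(2) = 0.6875`, `δ(32) = 0.0663`, `δ(64) = 0.0337`), which is the hypothesis `hfar` of (E72b) `load_split` for the
pair (crude chain at `z`, hyperbolic chain at `Rz`).  §5 (appended, same generation) is the companion GEOMETRIC CONSTANT of that recursion: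
**`readWindow_scale_le`: `S_{K,j} ≤ √(K∕z)·S_{z,j}` for `0 < z ≤ K`** (termwise `√(K∕(K+l+1)) ≤ √(K∕z)·√(z∕(z+l+1))`; `S` written as in (E65a)
`load_budget_window`) and `charge_scale_le` — at every scale an age `z` is charged at least `1∕√(K∕z)` of what an age `K ≥ z` is charged, so under the same
slacks the young's maximal feasible load is at most `√R` times that of a virtual young at `Rz`: `C_R ≤ √R` (README §4; the measured `0.82–0.86·√R` had the far
scales capped at `512z`).  NUMERICS of record (`g63/numerics/t30.py`, `t31.py`): the hyperbolic chain with `a = 1.2` closes over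
(E65a)'s budget polytope exactly like the crude one (sup ρ̄ 0.74–0.77, sup x·V̄ ≤ 0.19); the pure moment weights `2∕r` (`a = 0`) do NOT (dense age sets).
NOT CLAIMED: anything about the flow (the inequality `θ̂ ≤ θ̄` is the READMEs' bookkeeping of (E58b)∕(E63a)); the static closure; anything printed.
-/
noncomputable section
open Finset

namespace Summit.QuantumFields.BalabanUV.Beta.EriceRemainderEnclosureHistoryAutonomyComparisonAgeCompositionStaticChainHyperbolic

open Summit.QuantumFields.BalabanUV.Beta.EriceRemainderEnclosureHistoryAutonomyComparisonAgeCompositionStaticChainNormalForm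

/-! ## §1 Two elementary minorants -/

/-- `√(r∕(r+1)) ≥ 2r∕(2r+1)` for `r ≥ 0` (squaring: `(2r+1)² ≥ 4r(r+1)`); i.e. `1∕√(1+u) ≥ 1∕(1+u∕2)`. [folklore] -/
theorem sqrt_ratio_ge {r : ℝ} (hr : 0 ≤ r) : 2 * r / (2 * r + 1) ≤ Real.sqrt (r / (r + 1)) := by
  have h1 : 0 < 2 * r + 1 := by linarith
  have h2 : 0 < r + 1 := by linarith
  have hsq : (2 * r / (2 * r + 1)) ^ 2 ≤ r / (r + 1) := by
    rw [div_pow, div_le_div_iff₀ (by positivity) h2]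
    nlinarith
  calc 2 * r / (2 * r + 1) = Real.sqrt ((2 * r / (2 * r + 1)) ^ 2) := (Real.sqrt_sq (by positivity)).symm
    _ ≤ Real.sqrt (r / (r + 1)) := Real.sqrt_le_sqrt hsq

/-- **THE PERSISTENCE FACTOR DOMINATES ITS RATIONAL MINORANT**: `(r∕(r+1))·√(r∕(r+1))·e^{−1∕(2r)} ≥ r(2r−1)∕((r+1)(2r+1))` for `r > 0`
(`e^{−x} ≥ 1 − x` and `sqrt_ratio_ge`; for `r < ½` the minorant is negative and the bound is trivial). [folklore] -/
theorem persistence_ge_rational {r : ℝ} (hr : 0 < r) :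
    r * (2 * r - 1) / ((r + 1) * (2 * r + 1)) ≤ r / (r + 1) * Real.sqrt (r / (r + 1)) * Real.exp (-(1 / (2 * r))) := by
  have h2 : 0 < r + 1 := by linarith
  have h3 : 0 < 2 * r + 1 := by linarith
  have hA : r / (r + 1) * (2 * r / (2 * r + 1)) ≤ r / (r + 1) * Real.sqrt (r / (r + 1)) :=
    mul_le_mul_of_nonneg_left (sqrt_ratio_ge hr.le) (div_nonneg hr.le h2.le)
  have hA0 : 0 ≤ r / (r + 1) * (2 * r / (2 * r + 1)) := by positivity
  have hB : 1 - 1 / (2 * r) ≤ Real.exp (-(1 / (2 * r))) := by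
    have := Real.add_one_le_exp (-(1 / (2 * r))); linarith
  have hB0 : 0 ≤ Real.exp (-(1 / (2 * r))) := (Real.exp_pos _).le
  have hid : r * (2 * r - 1) / ((r + 1) * (2 * r + 1)) = r / (r + 1) * (2 * r / (2 * r + 1)) * (1 - 1 / (2 * r)) := by
    field_simp
  rw [hid]
  calc r / (r + 1) * (2 * r / (2 * r + 1)) * (1 - 1 / (2 * r))
      ≤ r / (r + 1) * (2 * r / (2 * r + 1)) * Real.exp (-(1 / (2 * r))) := mul_le_mul_of_nonneg_left hB hA0
    _ ≤ r / (r + 1) * Real.sqrt (r / (r + 1)) * Real.exp (-(1 / (2 * r))) := mul_le_mul_of_nonneg_right hA hB0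

/-! ## §2 The hyperbolic majorant -/

/-- **THE HYPERBOLIC MAJORANT OF THE PERSISTENCE DEFECT.**  For every `r > 0`:
`θ̄(r) = 1 − (r∕(r+1))·√(r∕(r+1))·e^{−1∕(2r)} ≤ 2∕(r + 6∕5)`.  Proof: by `persistence_ge_rational` it suffices that
`1 − r(2r−1)∕((r+1)(2r+1)) = (4r+1)∕((r+1)(2r+1)) ≤ 2∕(r+6∕5)`, i.e. `(4r+1)(5r+6) ≤ 10(r+1)(2r+1)`, i.e. `0 ≤ r + 4`.  (Best constant numerically
`1.375 = 11∕8`, asymptotically sharp; `6∕5` leaves `≈ 0.1∕r²`.) [folklore] -/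
theorem thetabar_le_hyperbolic {r : ℝ} (hr : 0 < r) :
    1 - r / (r + 1) * Real.sqrt (r / (r + 1)) * Real.exp (-(1 / (2 * r))) ≤ 2 / (r + 6 / 5) := by
  have h := persistence_ge_rational hr
  have h2 : 0 < r + 1 := by linarith
  have h3 : 0 < 2 * r + 1 := by linarith
  have h4 : 0 < r + 6 / 5 := by linarith
  have hrat : 1 - r * (2 * r - 1) / ((r + 1) * (2 * r + 1)) ≤ 2 / (r + 6 / 5) := by
    have hid : 1 - r * (2 * r - 1) / ((r + 1) * (2 * r + 1)) = (4 * r + 1) / ((r + 1) * (2 * r + 1)) := by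
      field_simp
      ring
    rw [hid, div_le_div_iff₀ (mul_pos h2 h3) h4]
    nlinarith
  linarith

/-- The same in the two-scale form used by the chain: an old age `k` seen from the young scale `z` (`0 < z`, `0 < k`) has crude defect
`θ̄(k∕z) ≤ 2z∕(k + (6∕5)z)` — the hyperbolic weight of (E72b) with `a = 6∕5`. [folklore] -/
theorem thetabar_le_hyperbolic_weight {z k : ℝ} (hz : 0 < z) (hk : 0 < k) :
    1 - (k / z) / (k / z + 1) * Real.sqrt ((k / z) / (k / z + 1)) * Real.exp (-(1 / (2 * (k / z)))) ≤ 2 * z / (k + 6 / 5 * z) := by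
  have h := thetabar_le_hyperbolic (div_pos hk hz)
  have hid : 2 / (k / z + 6 / 5) = 2 * z / (k + 6 / 5 * z) := by
    field_simp
  linarith [hid.symm.le, hid.le]

/-! ## §3 Range and monotonicity of `θ̄` -/

/-- `0 ≤ θ̄(r) ≤ 1` for `r > 0`: the persistence factor lies in `[0,1]`. [folklore] -/
theorem thetabar_mem_unit_interval {r : ℝ} (hr : 0 < r) :
    0 ≤ 1 - r / (r + 1) * Real.sqrt (r / (r + 1)) * Real.exp (-(1 / (2 * r))) ∧
      1 - r / (r + 1) * Real.sqrt (r / (r + 1)) * Real.exp (-(1 / (2 * r))) ≤ 1 := by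
  have h2 : 0 < r + 1 := by linarith
  have hq0 : 0 ≤ r / (r + 1) := div_nonneg hr.le h2.le
  have hq1 : r / (r + 1) ≤ 1 := by rw [div_le_one h2]; linarith
  have hs0 : 0 ≤ Real.sqrt (r / (r + 1)) := Real.sqrt_nonneg _
  have hs1 : Real.sqrt (r / (r + 1)) ≤ 1 := Real.sqrt_le_one.mpr hq1
  have he0 : 0 ≤ Real.exp (-(1 / (2 * r))) := (Real.exp_pos _).le
  have he1 : Real.exp (-(1 / (2 * r))) ≤ 1 := by
    rw [Real.exp_le_one_iff]; have : 0 < 1 / (2 * r) := by positivity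
    linarith
  constructor
  · have h1 : r / (r + 1) * Real.sqrt (r / (r + 1)) ≤ 1 := by nlinarith
    have h2' : r / (r + 1) * Real.sqrt (r / (r + 1)) * Real.exp (-(1 / (2 * r))) ≤ 1 := by
      nlinarith [mul_nonneg hq0 hs0]
    linarith
  · nlinarith [mul_nonneg (mul_nonneg hq0 hs0) he0]

/-- **`θ̄` IS NON-INCREASING**: for `0 < r ≤ r'`, `θ̄(r') ≤ θ̄(r)` (each factor of the persistence factor is non-decreasing in `r`).  Hence, seen from a
fixed young scale, the crude defects `θ̄(k_i∕z)` are non-decreasing towards the young age and the Abel increments of (E72a) `load_abel` are `≥ 0`.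
[folklore] -/
theorem thetabar_antitone {r r' : ℝ} (hr : 0 < r) (hrr' : r ≤ r') :
    1 - r' / (r' + 1) * Real.sqrt (r' / (r' + 1)) * Real.exp (-(1 / (2 * r'))) ≤
      1 - r / (r + 1) * Real.sqrt (r / (r + 1)) * Real.exp (-(1 / (2 * r))) := by
  have hr' : 0 < r' := lt_of_lt_of_le hr hrr'
  have h2 : 0 < r + 1 := by linarith
  have h2' : 0 < r' + 1 := by linarith
  have hq : r / (r + 1) ≤ r' / (r' + 1) := by
    rw [div_le_div_iff₀ h2 h2']; nlinarith
  have hq0 : 0 ≤ r / (r + 1) := div_nonneg hr.le h2.le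
  have hs : Real.sqrt (r / (r + 1)) ≤ Real.sqrt (r' / (r' + 1)) := Real.sqrt_le_sqrt hq
  have hs0 : 0 ≤ Real.sqrt (r / (r + 1)) := Real.sqrt_nonneg _
  have he : Real.exp (-(1 / (2 * r))) ≤ Real.exp (-(1 / (2 * r'))) := by
    rw [Real.exp_le_exp, neg_le_neg_iff]
    exact one_div_le_one_div_of_le (by positivity) (by linarith)
  have he0 : 0 ≤ Real.exp (-(1 / (2 * r))) := (Real.exp_pos _).le
  have hprod : r / (r + 1) * Real.sqrt (r / (r + 1)) * Real.exp (-(1 / (2 * r))) ≤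
      r' / (r' + 1) * Real.sqrt (r' / (r' + 1)) * Real.exp (-(1 / (2 * r'))) :=
    mul_le_mul (mul_le_mul hq hs hs0 (hq0.trans hq)) he he0
      (mul_nonneg (hq0.trans hq) (hs0.trans hs))
  linarith

/-! ## §4 Far decay of the crude defects (with (E72b) `hyperbolic_weight_decay`) -/

/-- **FAR DECAY OF THE CRUDE DEFECTS.**  For a young scale `z > 0`, a block ratio `R ≥ 1` and an old age `k ≥ Rz`:
`θ̄(k∕z) ≤ (11∕(5R+6))·(2Rz∕(k + (6∕5)Rz))` — the crude chain's far defects seen from `z` are at most `δ(R) = (1 + 6∕5)∕(R + 6∕5) = 11∕(5R+6)` times the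
hyperbolic defects (constant `6∕5`) seen from the splitting scale `Rz`.  This is the hypothesis `hfar` of (E72b) `load_split` for the pair (crude chain,
hyperbolic chain at the splitting scale); `δ(2) = 11∕16`, `δ(32) = 11∕166`, `δ(64) = 11∕326`. [folklore] -/
theorem thetabar_far_decay {z k R : ℝ} (hz : 0 < z) (hR : 1 ≤ R) (hk : R * z ≤ k) :
    1 - (k / z) / (k / z + 1) * Real.sqrt ((k / z) / (k / z + 1)) * Real.exp (-(1 / (2 * (k / z)))) ≤
      11 / (5 * R + 6) * (2 * (R * z) / (k + 6 / 5 * (R * z))) := by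
  have hk0 : 0 < k := lt_of_lt_of_le (by nlinarith) hk
  have h1 := thetabar_le_hyperbolic_weight hz hk0
  have h2 := hyperbolic_weight_decay (a := 6 / 5) hz hR (by norm_num) hk
  have hid : (1 + 6 / 5) / (R + 6 / 5) = 11 / (5 * R + 6) := by
    rw [div_eq_div_iff (by linarith) (by linarith)]; ring
  rw [hid] at h2
  exact h1.trans h2

/-! ## §5 The geometric constant of the far recursion: a virtual young at `K ≥ z` is charged at most `√(K∕z)` times the young -/

/-- Termwise scaling of (E65a)'s window weights: for `0 < z ≤ K` and every lag `l`, `√(K∕(K+l+1)) ≤ √(K∕z)·√(z∕(z+l+1))` (square: `K∕(K+l+1) ≤ K∕(z+l+1)`).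
[folklore] -/
theorem sqrt_window_summand_scale {z K l : ℝ} (hz : 0 < z) (hzK : z ≤ K) (hl : 0 ≤ l) :
    Real.sqrt (K / (K + l + 1)) ≤ Real.sqrt (K / z) * Real.sqrt (z / (z + l + 1)) := by
  have hK : 0 < K := lt_of_lt_of_le hz hzK
  rw [← Real.sqrt_mul (div_nonneg hK.le hz.le)]
  apply Real.sqrt_le_sqrt
  rw [div_mul_div_comm, div_le_div_iff₀ (by positivity) (by positivity)]
  nlinarith [mul_nonneg hK.le (mul_nonneg hz.le hl), mul_nonneg hK.le hz.le]

/-- **WINDOW READS SCALE AT MOST LIKE `√(K∕z)`**: for `0 < z ≤ K` and every window length `j`,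
`S_{K,j} = Σ_{l<j} √(K∕(K+l+1)) ≤ √(K∕z)·Σ_{l<j} √(z∕(z+l+1)) = √(K∕z)·S_{z,j}` (the sums are (E65a) `load_budget_window`'s `S`, written as there).  Consequence
(README `g63/e72` §4): at every scale `J` the charge of an age `z` is at least `1∕√(K∕z)` times the charge of an age `K ≥ z` (`S_{z,J}∕max(z,J) ≥
(S_{K,J}∕max(K,J))∕√(K∕z)` since also `max(z,J) ≤ max(K,J)`), so the young's maximal feasible load is at most `√R` times that of a virtual young at `K = Rz`
under the same slacks: the far recursion's geometric constant is `C_R ≤ √R`. [folklore] -/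
theorem readWindow_scale_le {z K : ℝ} (hz : 0 < z) (hzK : z ≤ K) (j : ℕ) :
    ∑ l ∈ range j, Real.sqrt (K / (K + l + 1)) ≤ Real.sqrt (K / z) * ∑ l ∈ range j, Real.sqrt (z / (z + l + 1)) := by
  rw [mul_sum]
  exact sum_le_sum fun l _ => sqrt_window_summand_scale hz hzK (Nat.cast_nonneg l)

/-- **THE YOUNG IS CHARGED AT LEAST `1∕√(K∕z)` OF A VIRTUAL YOUNG AT `K`.**  For `0 < z ≤ K` and a scale `J > 0` with `max(z,J) ≤ M_z`, `max(K,J) = M_K`,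
`M_z ≤ M_K` (the normalisations of (E65a)'s budget: an age `k` is charged `S_{k,J}∕max(k,J)`): `S_{K,J}∕M_K ≤ √(K∕z)·(S_{z,J}∕M_z)`.  Hence a slack `σ_J`
that caps the virtual young at `K` by `σ_J·M_K∕S_{K,J}` caps the young at `z` by at most `√(K∕z)` times as much. [folklore] -/
theorem charge_scale_le {z K Mz MK : ℝ} (hz : 0 < z) (hzK : z ≤ K) (hMz : 0 < Mz) (hM : Mz ≤ MK) (j : ℕ) :
    (∑ l ∈ range j, Real.sqrt (K / (K + l + 1))) / MK ≤ Real.sqrt (K / z) * ((∑ l ∈ range j, Real.sqrt (z / (z + l + 1))) / Mz) := by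
  have hMK : 0 < MK := lt_of_lt_of_le hMz hM
  have hS0 : 0 ≤ ∑ l ∈ range j, Real.sqrt (z / (z + l + 1)) := sum_nonneg fun _ _ => Real.sqrt_nonneg _
  have hR0 : 0 ≤ Real.sqrt (K / z) := Real.sqrt_nonneg _
  calc (∑ l ∈ range j, Real.sqrt (K / (K + l + 1))) / MK
      ≤ (Real.sqrt (K / z) * ∑ l ∈ range j, Real.sqrt (z / (z + l + 1))) / MK :=
        div_le_div_of_nonneg_right (readWindow_scale_le hz hzK j) hMK.le
    _ ≤ (Real.sqrt (K / z) * ∑ l ∈ range j, Real.sqrt (z / (z + l + 1))) / Mz :=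
        div_le_div_of_nonneg_left (mul_nonneg hR0 hS0) hMz hM
    _ = Real.sqrt (K / z) * ((∑ l ∈ range j, Real.sqrt (z / (z + l + 1))) / Mz) := by ring

end Summit.QuantumFields.BalabanUV.Beta.EriceRemainderEnclosureHistoryAutonomyComparisonAgeCompositionStaticChainHyperbolic

end
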